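import Summits.QuantumAdvantage.QuantumAdvantage.Theorems.AnchorDialDatum
import Summits.QuantumAdvantage.AdviceFreeQNC0.DWalkOneBell
import Summits.QuantumAdvantage.QuantumAdvantage.Theorems.HolonomyDialDecode

/-!
# AnchorDial — Final (cell decomp-qadv, seat lens-2, generation 14 rev 3; supports item 26531 `ExactnessDial.PolyLossOddU3`)

§10–§11 of the node, engine inputs (E3) and (E4) BUILT.  §10 PLACEMENT: `exists_mul_le_of_sum_le`, `sum_sites_le`, **`placement`**
(some offset `t < m` puts at most the average instability and anchor mass on the four sites `i·m + t`), the anchor histogram `Hc` with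
`card_site_le` / `sum_Hc_le`.  §11 ASSEMBLY: the one analytic input left, **`Equi5`** (five-block parity equidistribution on a
low-degree class, Smolensky-grade) and its schema **`Equi5Hyp`**; `card_DatT` (`3^21` datum classes), `card_odd_ge` / `HolonomyDial.card_odd_le`,
**`shell_at`** (the counting shell with the datum plugged in), `arith_core` / `real_tail` and
**`movingPointerLoss3_of_equi5` / `movingPointerLoss3_of_equi5Hyp`**: the crux `MovingPointerLoss3` FOLLOWS from `Equi5Hyp` with
exponent `C = 1` (constant loss `≥ 2^{n-1}/47`); `closes_of_equi5Hyp : Equi5Hyp → PtrLocLift3 → DPLift3 → AdviceFreeQNC0Three`.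

Split (≤ 400 lines, part 7/7) of the node file `HOME/decomp-qadv-lens-2/g14/AnchorDial.lean` (rev 3; sha256 in SHA256SUMS.txt, farm rc 0, no
placeholders); declarations verbatim, namespace `Summit.QuantumAdvantage.QuantumAdvantage.Theorems.AnchorDial`.  Record: NODE-g14.md.
-/

set_option linter.dupNamespace false
set_option linter.unusedVariables false

noncomputable section

open scoped Classical

namespace Summit.QuantumAdvantage.QuantumAdvantage.Theorems.AnchorDial

open Finset
open Literature.Computability.QuantumComplexity Literature.Computability.QuantumComplexity.RingHLF
open Literature.Computability.MetaComplexity Literature.Computability.MetaComplexity.Smolensky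
open Summit.QuantumAdvantage.AdviceFreeQNC0
open Summit.QuantumAdvantage.QuantumAdvantage.Theses (ExactnessDial.PolyLossOddU3 ExactnessDial.DPLift3)
-- only the tree gadgets we use (the g13 package keeps landing under `Theorems.HolonomyDial`; no blanket `open`)
open Summit.QuantumAdvantage.QuantumAdvantage.Theorems.HolonomyDial (gCond selP selP_mem selP_apply)

variable {N : ℕ}

/-! ## §10 (E3) PLACEMENT: averaging the instability and the anchor histogram over the offset `t` -/

section Placement

/-- AnchorDialFinal helper `exists_mul_le_of_sum_le` (decomp-qadv land package; see the module docstring). -/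
theorem exists_mul_le_of_sum_le (m : ℕ) (hm : 0 < m) (g : ℕ → ℕ) (B : ℕ) (h : ∑ t ∈ range m, g t ≤ B) :
    ∃ t < m, m * g t ≤ B := by
  by_contra hc
  push Not at hc
  have hlt : ∑ t ∈ range m, B < ∑ t ∈ range m, m * g t :=
    sum_lt_sum_of_nonempty (by rw [nonempty_range_iff]; omega) fun t ht => hc t (mem_range.1 ht)
  rw [sum_const, card_range, smul_eq_mul, ← mul_sum] at hlt
  have := Nat.mul_le_mul_left m h
  omega

/-- AnchorDialFinal helper `sum_sites_le` (decomp-qadv land package; see the module docstring). -/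
theorem sum_sites_le (U : ℕ → ℕ) (m n : ℕ) (h5 : 5 * m ≤ n) :
    ∑ t ∈ range m, (U (m + t) + U (2 * m + t) + U (3 * m + t) + U (4 * m + t)) ≤ ∑ a ∈ range n, U a := by
  rw [sum_add_distrib, sum_add_distrib, sum_add_distrib]
  have e1 : ∑ a ∈ Ico m (2 * m), U a = ∑ t ∈ range m, U (m + t) := by
    rw [Finset.sum_Ico_eq_sum_range, show 2 * m - m = m by omega]
  have e2 : ∑ a ∈ Ico (2 * m) (3 * m), U a = ∑ t ∈ range m, U (2 * m + t) := by
    rw [Finset.sum_Ico_eq_sum_range, show 3 * m - 2 * m = m by omega]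
  have e3 : ∑ a ∈ Ico (3 * m) (4 * m), U a = ∑ t ∈ range m, U (3 * m + t) := by
    rw [Finset.sum_Ico_eq_sum_range, show 4 * m - 3 * m = m by omega]
  have e4 : ∑ a ∈ Ico (4 * m) (5 * m), U a = ∑ t ∈ range m, U (4 * m + t) := by
    rw [Finset.sum_Ico_eq_sum_range, show 5 * m - 4 * m = m by omega]
  have c12 := sum_Ico_consecutive U (show m ≤ 2 * m by omega) (show 2 * m ≤ 3 * m by omega)
  have c13 := sum_Ico_consecutive U (show m ≤ 3 * m by omega) (show 3 * m ≤ 4 * m by omega)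
  have c14 := sum_Ico_consecutive U (show m ≤ 4 * m by omega) (show 4 * m ≤ 5 * m by omega)
  have hsub : Ico m (5 * m) ⊆ range n := by
    rw [range_eq_Ico]
    exact Ico_subset_Ico (Nat.zero_le _) h5
  have hle := sum_le_sum_of_subset (f := U) hsub
  omega

/-- **placement**: some offset `t < m` makes the four sites `i·m + t` carry at most the average instability and
anchor mass: `m·(512·Σ_i U(b_i) + 32·Σ_i H(b_i)) ≤ 512·Σ_{a<n} U(a) + 32·Σ_{a<n} H(a)`. -/
theorem placement (m n : ℕ) (hm : 0 < m) (h5 : 5 * m ≤ n) (U H : ℕ → ℕ) :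
    ∃ t < m, m * (512 * (U (m + t) + U (2 * m + t) + U (3 * m + t) + U (4 * m + t))
      + 32 * (H (m + t) + H (2 * m + t) + H (3 * m + t) + H (4 * m + t)))
      ≤ 512 * ∑ a ∈ range n, U a + 32 * ∑ a ∈ range n, H a := by
  refine exists_mul_le_of_sum_le m hm _ _ ?_
  rw [sum_add_distrib, ← mul_sum, ← mul_sum]
  have hU := sum_sites_le U m n h5
  have hH := sum_sites_le H m n h5
  have := Nat.mul_le_mul_left 512 hU
  have := Nat.mul_le_mul_left 32 hH
  omega

/-- anchor histogram: odd inputs uniquely anchored at ring position `a`. -/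
def Hc (A : Fin N → CubeFn (ZMod 3) N) (a : ℕ) : ℕ :=
  (univ.filter fun x : Fin N → Bool => OddZeros x ∧ ∃ k, anc A x = {k} ∧ k.val = a).card

/-- AnchorDialFinal helper `card_site_le` (decomp-qadv land package; see the module docstring). -/
theorem card_site_le (A : Fin N → CubeFn (ZMod 3) N) (b₁ b₂ b₃ b₄ : ℕ) :
    (univ.filter fun x : Fin N → Bool => OddZeros x ∧
        ∃ k, anc A x = {k} ∧ (k.val = b₁ ∨ k.val = b₂ ∨ k.val = b₃ ∨ k.val = b₄)).card
      ≤ Hc A b₁ + Hc A b₂ + Hc A b₃ + Hc A b₄ := by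
  unfold Hc
  refine le_trans (card_le_card fun x hx => ?_) ((card_union_le _ _).trans (Nat.add_le_add_right
    ((card_union_le _ _).trans (Nat.add_le_add_right (card_union_le _ _) _)) _))
  rw [mem_filter] at hx
  obtain ⟨_, hodd, k, hk, h⟩ := hx
  simp only [mem_union, mem_filter, mem_univ, true_and]
  rcases h with h | h | h | h
  · exact Or.inl (Or.inl (Or.inl ⟨hodd, k, hk, h⟩))
  · exact Or.inl (Or.inl (Or.inr ⟨hodd, k, hk, h⟩))
  · exact Or.inl (Or.inr ⟨hodd, k, hk, h⟩)
  · exact Or.inr ⟨hodd, k, hk, h⟩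

/-- AnchorDialFinal helper `sum_Hc_le` (decomp-qadv land package; see the module docstring). -/
theorem sum_Hc_le (A : Fin N → CubeFn (ZMod 3) N) :
    ∑ a ∈ range N, Hc A a ≤ (univ.filter fun x : Fin N → Bool => OddZeros x).card := by
  unfold Hc
  rw [← card_biUnion]
  · refine card_le_card fun x hx => ?_
    rw [mem_biUnion] at hx
    obtain ⟨a, _, ha⟩ := hx
    rw [mem_filter] at ha ⊢
    exact ⟨mem_univ _, ha.2.1⟩
  · intro a _ a' _ haa'
    refine disjoint_filter.2 fun x _ h h' => haa' ?_
    obtain ⟨_, k, hk, hka⟩ := h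
    obtain ⟨_, k', hk', hka'⟩ := h'
    rw [hk, Finset.singleton_inj] at hk'
    rw [← hka, ← hka', hk']

end Placement


/-! ## §11 (E4) ASSEMBLY: the crux `MovingPointerLoss3` from FIVE-BLOCK PARITY EQUIDISTRIBUTION -/

section Assembly

/-- **the one analytic input left (E2)** — five-block parity EQUIDISTRIBUTION on a low-degree class: for every
`E ∈ lowDeg D'`, each of the 16 values of the four site parities `zvec` occurs on at most `1/32` of `{E = 1}`
among ODD inputs, up to `η`.  (Smolensky for the five parity blocks cut out by the sites — the g13 §H
`step_two_sided` / `chain4` pattern with five blocks; expected `η ≈ 2^N·D'/√m` for site spacing `m`.) -/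
def Equi5 (N D' b₁ b₂ b₃ b₄ η : ℕ) : Prop :=
  ∀ E : CubeFn (ZMod 3) N, E ∈ lowDeg (ZMod 3) N D' → ∀ z : Core.B4,
    32 * (univ.filter fun x : Fin N → Bool => OddZeros x ∧ E x = 1 ∧ zvec b₁ b₂ b₃ b₄ x = z).card ≤
      (univ.filter fun x : Fin N → Bool => E x = 1).card + 32 * η

/-- AnchorDialFinal helper `card_DatT` (decomp-qadv land package; see the module docstring). -/
theorem card_DatT : Fintype.card DatT = 10460353203 := by
  simp only [DatT, Fintype.card_prod, Fintype.card_fun, ZMod.card]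
  norm_num

/-- AnchorDialFinal helper `card_odd_ge` (decomp-qadv land package; see the module docstring). -/
theorem card_odd_ge (hN : 1 ≤ N) : 2 ^ (N - 1) ≤ (univ.filter fun x : Fin N → Bool => OddZeros x).card := by
  obtain ⟨m, rfl⟩ : ∃ m, N = m + 1 := ⟨N - 1, by omega⟩
  rw [Nat.add_sub_cancel]
  have h := two_pow_le_card_odd_class (n := m)
  refine le_trans h (le_of_eq (congrArg Finset.card (Finset.ext fun x => ?_)))
  simp only [mem_filter, OddZeros]

/-- the shell at admissible sites with EQUI: the datum of §9 discharges `hdat` and `hequi` of `count_shell`. -/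
theorem shell_at (A f : Fin N → CubeFn (ZMod 3) N) {D : ℕ} (hA : ∀ k, A k ∈ lowDeg (ZMod 3) N D)
    (hf : ∀ k, f k ∈ lowDeg (ZMod 3) N D) {b₁ b₂ b₃ b₄ : ℕ}
    (h12 : b₁ + 2 ≤ b₂) (h23 : b₂ + 2 ≤ b₃) (h34 : b₃ + 2 ≤ b₄) (h4N : b₄ + 3 ≤ N) (η : ℕ)
    (hE : Equi5 N (148 * D) b₁ b₂ b₃ b₄ η) :
    32 * (univ.filter fun x : Fin N → Bool => OddZeros x).card ≤
      32 * (univ.filter fun x : Fin N → Bool => OddZeros x ∧ (anc A x).card ≠ 1).card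
      + 512 * ((univ.filter fun x => UB A b₁ x).card + (univ.filter fun x => UB A b₂ x).card
          + (univ.filter fun x => UB A b₃ x).card + (univ.filter fun x => UB A b₄ x).card)
      + 32 * (univ.filter fun x : Fin N → Bool => OddZeros x ∧
          ∃ k, anc A x = {k} ∧ (k.val = b₁ ∨ k.val = b₂ ∨ k.val = b₃ ∨ k.val = b₄)).card
      + (10 * Fintype.card (Fin N → Bool) + 320 * Fintype.card DatT * η)
      + 512 * (univ.filter fun x : Fin N → Bool => OddZeros x ∧ ¬ CW A f x).card :=
  count_shell A f h12 h23 h34 h4N (datum A f b₁ b₂ b₃ b₄) sOfD gOfD wOfD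
    (fun x k hk => datum_faithful A f b₁ b₂ b₃ b₄ x k hk) η
    (fun δ z₀ => by
      have h := hE (classInd A f b₁ b₂ b₃ b₄ δ) (classInd_mem hA hf b₁ b₂ b₃ b₄ δ) z₀
      refine le_trans (le_of_eq (congrArg (32 * ·) (congrArg Finset.card (Finset.ext fun x => ?_))))
        (le_trans h (le_of_eq (congrArg (· + 32 * η) (congrArg Finset.card (Finset.ext fun x => ?_)))))
      · simp only [mem_filter, classInd_eq_one_iff]
      · simp only [mem_filter, classInd_eq_one_iff])

/-- the integer arithmetic of the assembly (loss fraction `≥ 1/47`). -/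
theorem arith_core (n m O P NU U4 SITE H4 SU SH L η : ℕ)
    (hm : 3200 ≤ m) (h7 : n ≤ 7 * m) (h47 : 47 ≤ n)
    (hOP : P ≤ O) (hOP' : O ≤ P)
    (hU : 4096 * NU ≤ P) (hS : 4096 * SU ≤ n * P)
    (hpl : m * (512 * U4 + 32 * H4) ≤ 512 * SU + 32 * SH)
    (hSH : SH ≤ O) (hsite : SITE ≤ H4) (hη : 1600 * 10460353203 * η ≤ P)
    (hsh : 32 * O ≤ 32 * NU + 512 * U4 + 32 * SITE + (20 * P + 320 * 10460353203 * η) + 512 * L) :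
    P ≤ n * L := by
  have hA : 4096 * (m * (512 * U4 + 32 * H4)) ≤ 512 * (n * P) + 131072 * O := by
    have := Nat.mul_le_mul_left 4096 hpl
    omega
  have hB : n * P ≤ 7 * (m * P) := by
    have h := Nat.mul_le_mul_right P h7
    rw [Nat.mul_assoc] at h
    exact h
  have hC : 131072 * P ≤ 41 * (m * P) := by
    have h := Nat.mul_le_mul_right P (show 131072 ≤ 41 * m by omega)
    rw [Nat.mul_assoc] at h
    exact h
  have hD : 4096 * (m * (512 * U4 + 32 * H4)) ≤ 3625 * (m * P) := by omega
  have hE : 4096 * (512 * U4 + 32 * H4) ≤ 3625 * P := by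
    have h : m * (4096 * (512 * U4 + 32 * H4)) ≤ m * (3625 * P) := by
      rw [Nat.mul_left_comm m 4096, Nat.mul_left_comm m 3625]
      exact hD
    exact Nat.le_of_mul_le_mul_left h (by omega)
  have hF : 47 * L ≤ n * L := Nat.mul_le_mul_right L h47
  omega

/-- AnchorDialFinal helper `real_tail` (decomp-qadv land package; see the module docstring). -/
theorem real_tail (n W P : ℕ) (hn : 1 ≤ n) (h : n * W + P ≤ n * P) :
    (W : ℝ) ≤ (1 - 1 / (n : ℝ) ^ 1) * (P : ℝ) := by
  have hn0 : (0 : ℝ) < n := by exact_mod_cast (show 0 < n by omega)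
  have hc : ((n * W + P : ℕ) : ℝ) ≤ ((n * P : ℕ) : ℝ) := by exact_mod_cast h
  push_cast at hc
  rw [pow_one]
  have e : (1 - 1 / (n : ℝ)) * (P : ℝ) = ((n : ℝ) * P - P) / n := by
    field_simp
  rw [e, le_div_iff₀ hn0]
  nlinarith

/-- **`MovingPointerLoss3` from five-block equidistribution** (E4): if for every `c` and all large `n` there
is a site spacing `m` (`3200 ≤ m`, `5m + 3 ≤ n ≤ 7m`) and an error `η` (`1600·3^21·η ≤ 2^{n-1}`) such that
`Equi5 n (148·(log₂ n)^c) (m+t) (2m+t) (3m+t) (4m+t) η` holds for every offset `t < m`, then the crux holds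
with exponent `C = 1` (in fact constant loss `≥ 2^{n-1}/47`). -/
theorem movingPointerLoss3_of_equi5
    (hEq : ∀ c : ℕ, ∃ n₀ : ℕ, ∀ n ≥ n₀, ∃ m η : ℕ, 3200 ≤ m ∧ 5 * m + 3 ≤ n ∧ n ≤ 7 * m ∧
      1600 * 10460353203 * η ≤ 2 ^ (n - 1) ∧
      ∀ t < m, Equi5 n (148 * (Nat.log 2 n) ^ c) (m + t) (2 * m + t) (3 * m + t) (4 * m + t) η) :
    MovingPointerLoss3 := by
  refine ⟨1, fun c => ?_⟩
  obtain ⟨n₀, hn₀⟩ := hEq c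
  refine ⟨n₀, fun n hn A f hA hf hU hS => ?_⟩
  obtain ⟨m, η, hm, h5, h7, hη, hE⟩ := hn₀ n hn
  -- placement of the four sites
  obtain ⟨t, ht, hpl⟩ := placement m n (by omega) (by omega)
    (fun a => (univ.filter fun x : Fin n → Bool => UB A a x).card) (Hc A)
  -- the shell at the sites
  have hsh := shell_at A f hA hf (b₁ := m + t) (b₂ := 2 * m + t) (b₃ := 3 * m + t) (b₄ := 4 * m + t)
    (by omega) (by omega) (by omega) (by omega) η (hE t ht)
  rw [card_DatT, Fintype.card_fun, Fintype.card_bool, Fintype.card_fin] at hsh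
  -- the hypotheses of the crux in shell vocabulary
  have hU' : 4096 * (univ.filter fun x : Fin n → Bool => OddZeros x ∧ (anc A x).card ≠ 1).card ≤ 2 ^ (n - 1) := hU
  have hS' : 4096 * ∑ a ∈ range n, (univ.filter fun x : Fin n → Bool => UB A a x).card ≤ n * 2 ^ (n - 1) := by
    have e : ∀ a : ℕ, (univ.filter fun x : Fin n → Bool => UB A a x) = (univ.filter fun x : Fin n → Bool =>
        OddZeros x ∧ ∃ k : Fin n, ¬ ((A k (flip2 a (a + 1) x) = 1) ↔ (A k x = 1))) := fun a => by
      ext x; simp only [mem_filter, UB]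
    simp_rw [e]
    exact hS
  have hO := card_odd_ge (N := n) (by omega)
  have hO' := HolonomyDial.card_odd_le (n := n) (by omega)
  have hSH := sum_Hc_le A
  have hsite := card_site_le A (m + t) (2 * m + t) (3 * m + t) (4 * m + t)
  have h2n : 2 ^ n = 2 * 2 ^ (n - 1) := by
    rw [← pow_succ']
    congr 1
    omega
  rw [h2n] at hsh
  have key := arith_core n m _ (2 ^ (n - 1)) _ _ _ _ _ _
    ((univ.filter fun x : Fin n → Bool => OddZeros x ∧ ¬ CW A f x).card) η hm h7 (by omega) hO hO' hU' hS' hpl hSH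
    hsite hη (by omega)
  -- winners + losers = odd class
  have hWL := Finset.card_filter_add_card_filter_not (s := (univ : Finset (Fin n → Bool)).filter fun x => OddZeros x)
    (CW A f)
  rw [filter_filter, filter_filter] at hWL
  have eW : (univ.filter fun x : Fin n → Bool => OddZeros x ∧ ∃ k : Fin n,
      (univ.filter fun k' : Fin n => A k' x = 1) = {k} ∧ gCond x ((k.val + (if f k x = 1 then 0 else 1)) % n)) =
      (univ.filter fun x : Fin n → Bool => OddZeros x ∧ CW A f x) := by
    ext x; simp only [mem_filter, CW, anc]
  rw [eW]
  have hfin : n * (univ.filter fun x : Fin n → Bool => OddZeros x ∧ CW A f x).card + 2 ^ (n - 1) ≤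
      n * 2 ^ (n - 1) := by
    have h1 := Nat.mul_le_mul_left n (show (univ.filter fun x : Fin n → Bool => OddZeros x ∧ CW A f x).card +
      (univ.filter fun x : Fin n → Bool => OddZeros x ∧ ¬ CW A f x).card ≤ 2 ^ (n - 1) by omega)
    rw [Nat.mul_add] at h1
    omega
  have hreal := real_tail n _ (2 ^ (n - 1)) (by omega) hfin
  push_cast at hreal
  exact hreal

/-- **(E2) as one hypothesis schema**: admissible spacings with five-block equidistribution exist for all large `n`.
THEOREM-GRADE (Smolensky, g13 §H `step_two_sided` chain with five blocks; `m` odd, `6m ≤ n ≤ 7m`,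
`η = ⌈5·2^n·296D'·C(m,⌊m/2⌋)/2^m⌉`). The only input of the crux not built in this file. -/
def Equi5Hyp : Prop :=
  ∀ c : ℕ, ∃ n₀ : ℕ, ∀ n ≥ n₀, ∃ m η : ℕ, 3200 ≤ m ∧ 5 * m + 3 ≤ n ∧ n ≤ 7 * m ∧
    1600 * 10460353203 * η ≤ 2 ^ (n - 1) ∧
    ∀ t < m, Equi5 n (148 * (Nat.log 2 n) ^ c) (m + t) (2 * m + t) (3 * m + t) (4 * m + t) η

/-- the crux from (E2). -/
theorem movingPointerLoss3_of_equi5Hyp (h : Equi5Hyp) : MovingPointerLoss3 := movingPointerLoss3_of_equi5 h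

/-- the whole dial from (E2), the residual and the outer lift: `Equi5Hyp → PtrLocLift3 → DPLift3 → AdviceFreeQNC0Three`. -/
theorem closes_of_equi5Hyp (hE : Equi5Hyp) (hL : PtrLocLift3) (hD : ExactnessDial.DPLift3) : AdviceFreeQNC0Three :=
  closes (movingPointerLoss3_of_equi5 hE) hL hD

end Assembly

end Summit.QuantumAdvantage.QuantumAdvantage.Theorems.AnchorDial

end
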